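import Literature.AlgebraicGeometry.HodgeTheory.PrimitiveClassesKunnethDecomposition
import HarnessLib

/-!
# The summands of André's canonical isomorphism `P•(X × Y) ≅ ⊕ P•(X) ⊗ P•(Y)` are canonical — they are the joint eigenspaces of the
# two Casimir operators in `P_{−k}(M ⊗ N)` — and the decomposition degree by degree on `H^c((Y × Z)(ℂ); ℂ)`

Family `hodge`, lane `lit-hodgefound` (Track 2 foundations library), layer `Literature/AlgebraicGeometry/HodgeTheory` (with the
abstract §1 in namespace `Literature.Algebra.Lie`, next to its only carrier, as in the seat's `PrimitiveClassesKunnethDecomposition.lean`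
whose §1 it continues); prover seat `lit-hodgefound-p21` (generation 38, row g38-#4), sequel of g38-#3
`HodgeTheory/PrimitiveClassesKunnethDecomposition` (`P_{−k}(M ⊗ N) = ⊕_{(a,b)} Ψ_{a,b,(a+b−k)/2}(P_{−a}(M) ⊗ P_{−b}(N))`, and on
`H•((Y × Z)(ℂ); ℂ)`), g38-#2 `Algebra/Lie/LefschetzModuleClebschGordanMap` (the maps `Ψ_{a,b,s}` and the two Casimirs `C_M ⊗ 1`, `1 ⊗ C_N`,
which act on `Ψ_{a,b,s}(P_{−a} ⊗ P_{−b})` by `a² + 2a`, `b² + 2b`) and g36-#2 `HodgeTheory/LefschetzOperatorsKunneth` (the dictionary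
`P_{−a}(H•(Y)) ∩ Hⁱ = Pⁱ(Y)`, `i + a = dim Y`).  THEOREMS ONLY (no definition, no named fact, no instance; D-0026 net debt `0`).

## Sources, VERBATIM

* Y. André, *Pour une théorie inconditionnelle des motifs*, Publ. Math. IHÉS 83 (1996) [Andre1996Motifs], §1.3 p. 12 (held
  `paper:doi-10-1007-bf02698643` p0009 L38–L43): «Par le formalisme des `𝔰𝔩₂`-triplets (cf. [D80] 1.6.12.1, avec le dictionnaire
  `N = ᶜΛ`, `Gr_i = H^{d−i}(X)`, `P_{−i} = P^{d−i}(X)`), on déduit de l'isomorphisme de `𝔰𝔩₂`-représentations `Sⁱ ⊗ Sʲ ≅ ⊕_k S^{i+j−2k}`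
  (Clebsch–Gordan) un isomorphisme canonique : `P•(X × Y) ≅ ⊕ … P•(X) ⊗ P•(Y)`; l'inclusion `P•(X) ⊗ P•(Y) ⊆ P•(X × Y)` fournie par
  cet isomorphisme est restriction de l'isomorphisme de Künneth.»
* J. E. Humphreys, *Introduction to Lie Algebras and Representation Theory*, GTM 9 [Humphreys1972], §6.2 (the Casimir element of a
  faithful representation acts by a scalar on an irreducible module), §7.2 (`V(m)`), §22.5 Exercise 7 (p. 126; held text p0170 L3):
  «If `n ≤ m`, then `V(m) ⊗ V(n) ≅ V(m+n) ⊕ V(m+n−2) ⊕ … ⊕ V(m−n)`, `n+1` summands in all».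
* W. Fulton, J. Harris, *Representation Theory*, GTM 129 [FultonHarrisGTM129], §11.1 (held text p0186 L1: «if `V = ⊕ V_α` and
  `W = ⊕ W_β` then `V ⊗ W = ⊕ (V_α ⊗ W_β)` …») and Exercise 11.11 (p0186 L18–L20).
* C. Voisin, *Hodge Theory and Complex Algebraic Geometry I* (2002) [VoisinHodgeI2002], §6.2.3 Def. 6.24 (`H^k_prim = ker L^{n−k+1}`,
  the tree's `lefschetzPrimitive`); A. Hatcher, *Algebraic Topology* (2002) [HatcherAT2002], §3.2 Thm. 3.16 (Künneth).

## What "canonique" means here, and what is proved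

The decomposition of g38-#3 is indexed by EXPLICIT maps `Ψ_{a,b,s}` (a normalisation of the lowest-weight vectors of the summands
`S^{a+b−2s} ⊂ Sᵃ ⊗ Sᵇ`).  Its SUMMANDS, however, are intrinsic: `M ⊗ N` is a module over `𝔰𝔩₂ × 𝔰𝔩₂` (the two commuting triples
`(e ⊗ 1, h ⊗ 1, f ⊗ 1)`, `(1 ⊗ e', 1 ⊗ h', 1 ⊗ f')`), the Casimir `C = 4fe + h² − 2h` of `(−h, f, e)` acts on the isotypic component of
type `Sᵃ` by `a² + 2a = a(a+2)` (Humphreys §6.2; `a ↦ a(a+2)` is injective), and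

* §1 (abstract, Lefschetz modules `(M, h, e)`, `(N, h', e')` over a field of characteristic `0`, `H = h ⊗ 1 + 1 ⊗ h' ≠ 0`):
  **`HasLefschetzProperty.range_clebschGordanMap_eq_inf_eigenspace`** — for `s ≤ min(a, b)`,
  `Ψ_{a,b,s}(P_{−a}(M) ⊗ P_{−b}(N)) = P_{−(a+b−2s)}(M ⊗ N) ∩ ker(C_M ⊗ 1 − (a²+2a)) ∩ ker(1 ⊗ C_N − (b²+2b))` (the `(Sᵃ ⊠ Sᵇ)`-isotypic part
  of the lowest-weight space); `….mem_range_clebschGordanMap_of_casimir` / `….eq_zero_of_casimir` (a primitive joint eigenvector is its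
  own `(a, b)`-component, and vanishes unless `|a − b| ≤ k ≤ a + b`, `k ≡ a + b`), **`….primitiveSpace_inf_eigenspace_eq_bot`** (the types
  that do not occur), **`….primitiveSpace_tensor_eq_biSup_inf_eigenspace`** (the decomposition in canonical form — the isotypic
  decomposition of `P_{−k}(M ⊗ N)` under `𝔰𝔩₂ × 𝔰𝔩₂`), `….iSupIndep_primitiveSpace_inf_eigenspace`; and the book-keeping lemma
  **`….biSup_range_clebschGordanMap_eq_primitiveSpace_of_eq_bot`** (the index set may be cut down to any box `a < D₀`, `b < D₀'` beyond
  which the primitive parts vanish; `clebschGordanMap_eq_zero_of_left/right`).  The proof of the canonicity: decompose a joint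
  eigenvector `x ∈ P_{−k}` along g38-#3 (`exists_sum_clebschGordanMap_eq`), apply `C_M ⊗ 1 − (a²+2a)` and `1 ⊗ C_N − (b²+2b)`, and use the
  uniqueness of the components (`clebschGordan_sum_unique`): every component other than `(a, b)` dies.
* §2 (carriers `H•(Y(ℂ); ℂ)`, `H•(Z(ℂ); ℂ)`, `H•((Y × Z)(ℂ); ℂ)` for `Y`, `Z` smooth projective over `ℂ` of dimensions `m`, `n`, hard
  Lefschetz classes `η`, `η'`, `θ = pr_Y^* η + pr_Z^* η'`): `primitiveSpace_complexPoints_eq_bot_of_lt` (`P_{−a}(H•(Y)) = 0` for `a > m`),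
  **`primitiveSpace_prod_eq_biSup_map_kunnethCross'`** (g38-#3's carrier decomposition with the index box `a ≤ m`, `b ≤ n` instead of a
  bound by `dim H•`), **`lefschetzPrimitive_prod_eq_biSup_comap_ofDegree`** (THE DECOMPOSITION DEGREE BY DEGREE: for `c + k = m + n`,
  `P^c(Y × Z) = ker L_θ^{k+1} ⊆ H^c` is the sum over the same pairs `(a, b)` of the degree-`c` parts of the Künneth images of
  `Ψ_{a,b,(a+b−k)/2}(P^{m−a}(Y) ⊗ P^{n−b}(Z))`), the dictionary **`kunnethCross_clebschGordanMap_tmul`** (the Künneth image of `Ψ_{a,b,s}(p ⊗ q)`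
  is the homogeneous class `Σ_l c_l · pr_Y^*(L_ηˡ p) ⌣ pr_Z^*(L_{η'}^{s−l} q) ∈ H^{i+j+2s}`, `c_l = clebschGordanCoeff a b s l`), and
  **`comap_ofDegree_map_kunnethCross_range_clebschGordanMap`** (that degree-`(i+j+2s)` part is the span of these classes over `p ∈ Pⁱ(Y)`,
  `q ∈ Pʲ(Z)`, `i + a = m`, `j + b = n`).

## SCOPE / NOT HERE

The Casimir description is given for the abstract modules only (on the carriers the operators `κ (C_Y ⊗ 1) κ⁻¹` have no simpler name
in the tree); rational Betti cohomology is not treated (no total-cohomology Künneth isomorphism over `ℚ` in the tree; the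
dimension count over `ℚ` is the seat's `BettiPrimitiveNumbersProducts`).

## References

* [Andre1996Motifs] Y. André, Publ. Math. IHÉS 83 (1996) 5–49, §1.3 (p. 12).
* [Humphreys1972] J. E. Humphreys, GTM 9 (1972), §6.2, §7.2, §22.5 Exercise 7 (p. 126).
* [FultonHarrisGTM129] W. Fulton, J. Harris, GTM 129 (1991), §11.1, Exercise 11.11.
* [LooijengaLunts1997] E. Looijenga, V. A. Lunts, Invent. Math. 129 (1997), §1 (1.1) p. 4.
* [VoisinHodgeI2002] C. Voisin, *Hodge Theory and Complex Algebraic Geometry I* (2002), §6.2.3 Def. 6.24.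
* [HatcherAT2002] A. Hatcher, *Algebraic Topology* (2002), §3.2 Thm. 3.16.
-/

noncomputable section

open scoped TensorProduct

/-! ### §1 The Clebsch–Gordan summands as joint eigenspaces of the two Casimirs -/

namespace Literature.Algebra.Lie

open Module Function Set
open HasLefschetzProperty (primitiveSpace mem_primitiveSpace_iff)

section Abstract

variable {K : Type*} [Field K] [CharZero K] {M N : Type*} [AddCommGroup M] [Module K M] [FiniteDimensional K M]
  [AddCommGroup N] [Module K N] [FiniteDimensional K N] {h e : Module.End K M} {h' e' : Module.End K N}

omit [FiniteDimensional K M] [FiniteDimensional K N] in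
/-- `a ↦ a² + 2a` is injective on `ℕ`, read in `K` (the Casimir eigenvalue determines the type). [cite: Humphreys1972, §7.2 and §22.5 Exercise 7] -/
private theorem cast_mul_add_injective : Function.Injective fun a : ℕ ↦ ((a * a + 2 * a : ℕ) : K) := by
  intro a b hab
  dsimp only at hab
  have h1 : a * a + 2 * a = b * b + 2 * b := by exact_mod_cast hab
  nlinarith [h1]

omit [CharZero K] [FiniteDimensional K M] [FiniteDimensional K N] in
/-- If `P_{−a}(M) = 0` then `Ψ_{a,b,s} = 0`. [cite: Humphreys1972, §22.5 Exercise 7 (p. 126)] -/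
theorem clebschGordanMap_eq_zero_of_left (h' e' : Module.End K N) {a : ℕ} (ha : primitiveSpace h e a = ⊥) (b s : ℕ) :
    clebschGordanMap h e h' e' a b s = 0 := by
  refine TensorProduct.ext' fun p q ↦ ?_
  have hp : (p : M) = 0 := (Submodule.mem_bot K).1 (ha ▸ p.2)
  rw [clebschGordanMap_tmul, LinearMap.zero_apply]
  exact Finset.sum_eq_zero fun l _ ↦ by rw [hp, map_zero, TensorProduct.zero_tmul, smul_zero]

omit [CharZero K] [FiniteDimensional K M] [FiniteDimensional K N] in
/-- If `P_{−b}(N) = 0` then `Ψ_{a,b,s} = 0`. [cite: Humphreys1972, §22.5 Exercise 7 (p. 126)] -/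
theorem clebschGordanMap_eq_zero_of_right (h e : Module.End K M) (a : ℕ) {b : ℕ} (hb : primitiveSpace h' e' b = ⊥) (s : ℕ) :
    clebschGordanMap h e h' e' a b s = 0 := by
  refine TensorProduct.ext' fun p q ↦ ?_
  have hq : (q : N) = 0 := (Submodule.mem_bot K).1 (hb ▸ q.2)
  rw [clebschGordanMap_tmul, LinearMap.zero_apply]
  exact Finset.sum_eq_zero fun l _ ↦ by rw [hq, map_zero, TensorProduct.tmul_zero, smul_zero]

/-- **The index set of the Clebsch–Gordan decomposition may be cut down to any box beyond which the primitive parts vanish**: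
if `P_{−a}(M) = 0` for `a ≥ D₀` and `P_{−b}(N) = 0` for `b ≥ D₀'` (e.g. `D₀ = depth + 1`; for `H•(Y(ℂ))`, `D₀ = dim Y + 1`), then
`P_{−k}(M ⊗ N) = ⊕_{a < D₀, b < D₀', |a−b| ≤ k ≤ a+b, k ≡ a+b} Ψ_{a,b,(a+b−k)/2}(P_{−a}(M) ⊗ P_{−b}(N))`.
[cite: Andre1996Motifs, §1.3 (p. 12)] [cite: Humphreys1972, §22.5 Exercise 7 (p. 126)] -/
theorem HasLefschetzProperty.biSup_range_clebschGordanMap_eq_primitiveSpace_of_eq_bot (L : HasLefschetzProperty h e)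
    (hgr : IsZGrading h) (L' : HasLefschetzProperty h' e') (hgr' : IsZGrading h') (h0 : h.rTensor N + h'.lTensor M ≠ 0)
    {D₀ D₀' : ℕ} (hD₀ : ∀ a, D₀ ≤ a → primitiveSpace h e a = ⊥) (hD₀' : ∀ b, D₀' ≤ b → primitiveSpace h' e' b = ⊥) (k : ℕ) :
    ⨆ ab ∈ (Finset.range D₀ ×ˢ Finset.range D₀').filter
        (fun ab : ℕ × ℕ ↦ ab.1 ≤ ab.2 + k ∧ ab.2 ≤ ab.1 + k ∧ k ≤ ab.1 + ab.2 ∧ (ab.1 + ab.2 + k) % 2 = 0),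
      LinearMap.range (clebschGordanMap h e h' e' ab.1 ab.2 ((ab.1 + ab.2 - k) / 2)) =
      primitiveSpace (h.rTensor N + h'.lTensor M) (e.rTensor N + e'.lTensor M) k := by
  classical
  rw [← L.biSup_range_clebschGordanMap_eq_primitiveSpace hgr L' hgr' h0 (le_max_right D₀ (finrank K M))
    (le_max_right D₀' (finrank K N)) k]
  refine le_antisymm (biSup_mono fun ab hab ↦ ?_) (iSup₂_le fun ab hab ↦ ?_)
  · simp only [Finset.mem_filter, Finset.mem_product, Finset.mem_range] at hab ⊢
    exact ⟨⟨lt_max_of_lt_left hab.1.1, lt_max_of_lt_left hab.1.2⟩, hab.2⟩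
  · by_cases h₁ : D₀ ≤ ab.1
    · rw [clebschGordanMap_eq_zero_of_left h' e' (hD₀ ab.1 h₁), LinearMap.range_zero]; exact bot_le
    by_cases h₂ : D₀' ≤ ab.2
    · rw [clebschGordanMap_eq_zero_of_right h e ab.1 (hD₀' ab.2 h₂), LinearMap.range_zero]; exact bot_le
    have hab' : ab ∈ (Finset.range D₀ ×ˢ Finset.range D₀').filter
        (fun ab : ℕ × ℕ ↦ ab.1 ≤ ab.2 + k ∧ ab.2 ≤ ab.1 + k ∧ k ≤ ab.1 + ab.2 ∧ (ab.1 + ab.2 + k) % 2 = 0) := by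
      simp only [Finset.mem_filter, Finset.mem_product, Finset.mem_range] at hab ⊢
      exact ⟨⟨by omega, by omega⟩, hab.2⟩
    exact le_biSup (fun ab : ℕ × ℕ ↦ LinearMap.range (clebschGordanMap h e h' e' ab.1 ab.2 ((ab.1 + ab.2 - k) / 2))) hab'

/-- Core of the canonicity: a `θ`-primitive vector of weight `−k` on which `C_M ⊗ 1` acts by `a² + 2a` and `1 ⊗ C_N` by `b² + 2b` IS its own
`(a, b)`-component — it lies in `Ψ_{a,b,(a+b−k)/2}(P_{−a} ⊗ P_{−b})`, and vanishes unless `|a − b| ≤ k ≤ a + b`, `k ≡ a + b`.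
[cite: Humphreys1972, §6.2 and §22.5 Exercise 7 (p. 126)] [cite: FultonHarrisGTM129, §11.1 Exercise 11.11] -/
private theorem HasLefschetzProperty.casimir_core (L : HasLefschetzProperty h e) (hgr : IsZGrading h)
    (L' : HasLefschetzProperty h' e') (hgr' : IsZGrading h') (h0 : h.rTensor N + h'.lTensor M ≠ 0) {k a b : ℕ} {x : M ⊗[K] N}
    (hx : x ∈ primitiveSpace (h.rTensor N + h'.lTensor M) (e.rTensor N + e'.lTensor M) k)
    (hxa : ((Sl2.casimir (-h) (L.dual hgr) e).rTensor N) x = ((a * a + 2 * a : ℕ) : K) • x)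
    (hxb : ((Sl2.casimir (-h') (L'.dual hgr') e').lTensor M) x = ((b * b + 2 * b : ℕ) : K) • x) :
    (¬ (a ≤ b + k ∧ b ≤ a + k ∧ k ≤ a + b ∧ (a + b + k) % 2 = 0) → x = 0) ∧
      x ∈ LinearMap.range (clebschGordanMap h e h' e' a b ((a + b - k) / 2)) := by
  classical
  set S : Finset (ℕ × ℕ) := (Finset.range (max (a + 1) (finrank K M)) ×ˢ Finset.range (max (b + 1) (finrank K N))).filter
    (fun ab : ℕ × ℕ ↦ ab.1 ≤ ab.2 + k ∧ ab.2 ≤ ab.1 + k ∧ k ≤ ab.1 + ab.2 ∧ (ab.1 + ab.2 + k) % 2 = 0) with hS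
  obtain ⟨y, hy, hsum⟩ := L.exists_sum_clebschGordanMap_eq hgr L' hgr' h0 (le_max_right (a + 1) (finrank K M))
    (le_max_right (b + 1) (finrank K N)) hx
  rw [← hS] at hsum
  -- the components off the row `a` vanish (first Casimir)
  have hya : ∀ ab ∈ S, ab.1 ≠ a → y ab = 0 := by
    intro ab hab hne
    have h1 := L.clebschGordan_sum_unique hgr L' hgr' (fun a b ↦ (a + b - k) / 2) (s := S)
      (y := fun ab ↦ ((ab.1 * ab.1 + 2 * ab.1 : ℕ) : K) • y ab) (y' := fun ab ↦ ((a * a + 2 * a : ℕ) : K) • y ab)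
      (fun ab _ ↦ Submodule.smul_mem _ _ (hy ab)) (fun ab _ ↦ Submodule.smul_mem _ _ (hy ab)) ?_ ab hab
    · have h2 : (((ab.1 * ab.1 + 2 * ab.1 : ℕ) : K) - ((a * a + 2 * a : ℕ) : K)) • y ab = 0 := by
        rw [sub_smul, sub_eq_zero]; exact h1
      rcases smul_eq_zero.1 h2 with h3 | h3
      · exact absurd (cast_mul_add_injective (sub_eq_zero.1 h3)) hne
      · exact h3
    · calc ∑ ab ∈ S, ((ab.1 * ab.1 + 2 * ab.1 : ℕ) : K) • y ab
          = ∑ ab ∈ S, ((Sl2.casimir (-h) (L.dual hgr) e).rTensor N) (y ab) :=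
            Finset.sum_congr rfl fun ab _ ↦ (L.rTensor_casimir_apply_of_mem_range hgr (hy ab)).symm
        _ = ((Sl2.casimir (-h) (L.dual hgr) e).rTensor N) x := by rw [← map_sum, hsum]
        _ = ∑ ab ∈ S, ((a * a + 2 * a : ℕ) : K) • y ab := by rw [hxa, ← Finset.smul_sum, hsum]
  -- the components off the column `b` vanish (second Casimir)
  have hyb : ∀ ab ∈ S, ab.2 ≠ b → y ab = 0 := by
    intro ab hab hne
    have h1 := L.clebschGordan_sum_unique hgr L' hgr' (fun a b ↦ (a + b - k) / 2) (s := S)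
      (y := fun ab ↦ ((ab.2 * ab.2 + 2 * ab.2 : ℕ) : K) • y ab) (y' := fun ab ↦ ((b * b + 2 * b : ℕ) : K) • y ab)
      (fun ab _ ↦ Submodule.smul_mem _ _ (hy ab)) (fun ab _ ↦ Submodule.smul_mem _ _ (hy ab)) ?_ ab hab
    · have h2 : (((ab.2 * ab.2 + 2 * ab.2 : ℕ) : K) - ((b * b + 2 * b : ℕ) : K)) • y ab = 0 := by
        rw [sub_smul, sub_eq_zero]; exact h1
      rcases smul_eq_zero.1 h2 with h3 | h3
      · exact absurd (cast_mul_add_injective (sub_eq_zero.1 h3)) hne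
      · exact h3
    · calc ∑ ab ∈ S, ((ab.2 * ab.2 + 2 * ab.2 : ℕ) : K) • y ab
          = ∑ ab ∈ S, ((Sl2.casimir (-h') (L'.dual hgr') e').lTensor M) (y ab) :=
            Finset.sum_congr rfl fun ab _ ↦ (L'.lTensor_casimir_apply_of_mem_range hgr' (hy ab)).symm
        _ = ((Sl2.casimir (-h') (L'.dual hgr') e').lTensor M) x := by rw [← map_sum, hsum]
        _ = ∑ ab ∈ S, ((b * b + 2 * b : ℕ) : K) • y ab := by rw [hxb, ← Finset.smul_sum, hsum]
  have hy0 : ∀ ab ∈ S, ab ≠ (a, b) → y ab = 0 := by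
    intro ab hab hne
    by_cases h1 : ab.1 = a
    · exact hyb ab hab fun h2 ↦ hne (Prod.ext h1 h2)
    · exact hya ab hab h1
  by_cases hv : a ≤ b + k ∧ b ≤ a + k ∧ k ≤ a + b ∧ (a + b + k) % 2 = 0
  · have hmem : (a, b) ∈ S := by
      simp only [hS, Finset.mem_filter, Finset.mem_product, Finset.mem_range]
      exact ⟨⟨lt_max_of_lt_left (Nat.lt_succ_self a), lt_max_of_lt_left (Nat.lt_succ_self b)⟩, hv⟩
    rw [Finset.sum_eq_single_of_mem (a, b) hmem fun ab hab hne ↦ hy0 ab hab hne] at hsum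
    exact ⟨fun hn ↦ absurd hv hn, hsum ▸ hy (a, b)⟩
  · have hx0 : x = 0 := by
      rw [← hsum]
      refine Finset.sum_eq_zero fun ab hab ↦ hy0 ab hab ?_
      rintro rfl
      exact hv (Finset.mem_filter.1 hab).2
    exact ⟨fun _ ↦ hx0, hx0 ▸ Submodule.zero_mem _⟩

/-- **A `θ`-primitive vector of `M ⊗ N` of weight `−k` on which the two Casimirs `C_M ⊗ 1`, `1 ⊗ C_N` act by `a² + 2a`, `b² + 2b` lies in the
Clebsch–Gordan summand `Ψ_{a,b,(a+b−k)/2}(P_{−a}(M) ⊗ P_{−b}(N))`** (`C = 4fe + h² − 2h` acts by `a² + 2a` on the isotypic component of `Sᵃ`).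
[cite: Humphreys1972, §6.2 (the Casimir acts by a scalar on an irreducible module) and §22.5 Exercise 7 (p. 126)]
[cite: FultonHarrisGTM129, §11.1 Exercise 11.11] -/
theorem HasLefschetzProperty.mem_range_clebschGordanMap_of_casimir (L : HasLefschetzProperty h e) (hgr : IsZGrading h)
    (L' : HasLefschetzProperty h' e') (hgr' : IsZGrading h') (h0 : h.rTensor N + h'.lTensor M ≠ 0) {k a b : ℕ} {x : M ⊗[K] N}
    (hx : x ∈ primitiveSpace (h.rTensor N + h'.lTensor M) (e.rTensor N + e'.lTensor M) k)
    (hxa : ((Sl2.casimir (-h) (L.dual hgr) e).rTensor N) x = ((a * a + 2 * a : ℕ) : K) • x)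
    (hxb : ((Sl2.casimir (-h') (L'.dual hgr') e').lTensor M) x = ((b * b + 2 * b : ℕ) : K) • x) :
    x ∈ LinearMap.range (clebschGordanMap h e h' e' a b ((a + b - k) / 2)) :=
  (L.casimir_core hgr L' hgr' h0 hx hxa hxb).2

/-- … and **it vanishes unless `|a − b| ≤ k ≤ a + b` and `k ≡ a + b (mod 2)`** (the types `S^k ⊂ Sᵃ ⊗ Sᵇ` that occur).
[cite: Humphreys1972, §22.5 Exercise 7 (p. 126)] [cite: FultonHarrisGTM129, §11.1 Exercise 11.11] -/
theorem HasLefschetzProperty.eq_zero_of_casimir (L : HasLefschetzProperty h e) (hgr : IsZGrading h)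
    (L' : HasLefschetzProperty h' e') (hgr' : IsZGrading h') (h0 : h.rTensor N + h'.lTensor M ≠ 0) {k a b : ℕ} {x : M ⊗[K] N}
    (hx : x ∈ primitiveSpace (h.rTensor N + h'.lTensor M) (e.rTensor N + e'.lTensor M) k)
    (hxa : ((Sl2.casimir (-h) (L.dual hgr) e).rTensor N) x = ((a * a + 2 * a : ℕ) : K) • x)
    (hxb : ((Sl2.casimir (-h') (L'.dual hgr') e').lTensor M) x = ((b * b + 2 * b : ℕ) : K) • x)
    (hn : ¬ (a ≤ b + k ∧ b ≤ a + k ∧ k ≤ a + b ∧ (a + b + k) % 2 = 0)) : x = 0 :=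
  (L.casimir_core hgr L' hgr' h0 hx hxa hxb).1 hn

/-- **THE CLEBSCH–GORDAN SUMMANDS ARE CANONICAL: `Ψ_{a,b,s}(P_{−a}(M) ⊗ P_{−b}(N)) = P_{−(a+b−2s)}(M ⊗ N) ∩ ker(C_M ⊗ 1 − (a²+2a))
∩ ker(1 ⊗ C_N − (b²+2b))`** for `s ≤ min(a, b)` — the `(Sᵃ ⊠ Sᵇ)`-isotypic part of the lowest-weight space `P_{−(a+b−2s)}` of
`M ⊗ N` under `𝔰𝔩₂ × 𝔰𝔩₂`; in particular the summand does not depend on the normalisation of the maps `Ψ`.  This is the sense in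
which André's isomorphism `P•(X × Y) ≅ ⊕ P•(X) ⊗ P•(Y)` is «canonique». [cite: Andre1996Motifs, §1.3 (p. 12, "un isomorphisme canonique")]
[cite: Humphreys1972, §6.2 and §22.5 Exercise 7 (p. 126)] [cite: FultonHarrisGTM129, §11.1 Exercise 11.11] -/
theorem HasLefschetzProperty.range_clebschGordanMap_eq_inf_eigenspace (L : HasLefschetzProperty h e) (hgr : IsZGrading h)
    (L' : HasLefschetzProperty h' e') (hgr' : IsZGrading h') (h0 : h.rTensor N + h'.lTensor M ≠ 0) {a b s : ℕ} (hsa : s ≤ a)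
    (hsb : s ≤ b) :
    LinearMap.range (clebschGordanMap h e h' e' a b s) =
      primitiveSpace (h.rTensor N + h'.lTensor M) (e.rTensor N + e'.lTensor M) (a + b - 2 * s) ⊓
        Module.End.eigenspace ((Sl2.casimir (-h) (L.dual hgr) e).rTensor N) ((a * a + 2 * a : ℕ) : K) ⊓
        Module.End.eigenspace ((Sl2.casimir (-h') (L'.dual hgr') e').lTensor M) ((b * b + 2 * b : ℕ) : K) := by
  refine le_antisymm (le_inf (le_inf (L.range_clebschGordanMap_le_primitiveSpace hgr L' hgr' h0 (by omega))
    (L.range_clebschGordanMap_le_eigenspace_rTensor hgr a b s)) (L'.range_clebschGordanMap_le_eigenspace_lTensor hgr' a b s))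
    fun x hx ↦ ?_
  obtain ⟨⟨hx₁, hx₂⟩, hx₃⟩ := hx
  have h1 := L.mem_range_clebschGordanMap_of_casimir hgr L' hgr' h0 hx₁ (Module.End.mem_eigenspace_iff.1 hx₂)
    (Module.End.mem_eigenspace_iff.1 hx₃)
  rwa [show (a + b - (a + b - 2 * s)) / 2 = s by omega] at h1

/-- **The joint eigenspaces that do not occur: `P_{−k}(M ⊗ N) ∩ ker(C_M ⊗ 1 − (a²+2a)) ∩ ker(1 ⊗ C_N − (b²+2b)) = 0` unless
`|a − b| ≤ k ≤ a + b`, `k ≡ a + b`** («`V(m) ⊗ V(n) ≅ V(m+n) ⊕ V(m+n−2) ⊕ … ⊕ V(m−n)`»). [cite: Humphreys1972, §22.5 Exercise 7 (p. 126)]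
[cite: FultonHarrisGTM129, §11.1 Exercise 11.11] -/
theorem HasLefschetzProperty.primitiveSpace_inf_eigenspace_eq_bot (L : HasLefschetzProperty h e) (hgr : IsZGrading h)
    (L' : HasLefschetzProperty h' e') (hgr' : IsZGrading h') (h0 : h.rTensor N + h'.lTensor M ≠ 0) {k a b : ℕ}
    (hn : ¬ (a ≤ b + k ∧ b ≤ a + k ∧ k ≤ a + b ∧ (a + b + k) % 2 = 0)) :
    primitiveSpace (h.rTensor N + h'.lTensor M) (e.rTensor N + e'.lTensor M) k ⊓
        Module.End.eigenspace ((Sl2.casimir (-h) (L.dual hgr) e).rTensor N) ((a * a + 2 * a : ℕ) : K) ⊓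
        Module.End.eigenspace ((Sl2.casimir (-h') (L'.dual hgr') e').lTensor M) ((b * b + 2 * b : ℕ) : K) = ⊥ := by
  rw [Submodule.eq_bot_iff]
  rintro x ⟨⟨hx₁, hx₂⟩, hx₃⟩
  exact L.eq_zero_of_casimir hgr L' hgr' h0 hx₁ (Module.End.mem_eigenspace_iff.1 hx₂) (Module.End.mem_eigenspace_iff.1 hx₃) hn

/-- **The Clebsch–Gordan decomposition in canonical form: `P_{−k}(M ⊗ N) = ⊕_{(a,b)} P_{−k}(M ⊗ N) ∩ ker(C_M ⊗ 1 − (a²+2a)) ∩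
ker(1 ⊗ C_N − (b²+2b))`**, over `a < D`, `b < D'` (`D ≥ dim M`, `D' ≥ dim N`) with `|a − b| ≤ k ≤ a + b`, `k ≡ a + b` — the isotypic
decomposition of `P_{−k}(M ⊗ N)` under `𝔰𝔩₂ × 𝔰𝔩₂`. [cite: Andre1996Motifs, §1.3 (p. 12)] [cite: Humphreys1972, §6.2 and §22.5 Exercise 7 (p. 126)]
[cite: FultonHarrisGTM129, §11.1 Exercise 11.11] -/
theorem HasLefschetzProperty.primitiveSpace_tensor_eq_biSup_inf_eigenspace (L : HasLefschetzProperty h e) (hgr : IsZGrading h)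
    (L' : HasLefschetzProperty h' e') (hgr' : IsZGrading h') (h0 : h.rTensor N + h'.lTensor M ≠ 0) {D D' : ℕ}
    (hD : finrank K M ≤ D) (hD' : finrank K N ≤ D') (k : ℕ) :
    primitiveSpace (h.rTensor N + h'.lTensor M) (e.rTensor N + e'.lTensor M) k =
      ⨆ ab ∈ (Finset.range D ×ˢ Finset.range D').filter
          (fun ab : ℕ × ℕ ↦ ab.1 ≤ ab.2 + k ∧ ab.2 ≤ ab.1 + k ∧ k ≤ ab.1 + ab.2 ∧ (ab.1 + ab.2 + k) % 2 = 0),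
        primitiveSpace (h.rTensor N + h'.lTensor M) (e.rTensor N + e'.lTensor M) k ⊓
          Module.End.eigenspace ((Sl2.casimir (-h) (L.dual hgr) e).rTensor N) ((ab.1 * ab.1 + 2 * ab.1 : ℕ) : K) ⊓
          Module.End.eigenspace ((Sl2.casimir (-h') (L'.dual hgr') e').lTensor M) ((ab.2 * ab.2 + 2 * ab.2 : ℕ) : K) := by
  rw [← L.biSup_range_clebschGordanMap_eq_primitiveSpace hgr L' hgr' h0 hD hD' k]
  refine (biSup_congr fun ab hab ↦ ?_).symm
  obtain ⟨-, h₁, h₂, h₃, h₄⟩ := Finset.mem_filter.1 hab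
  rw [L.biSup_range_clebschGordanMap_eq_primitiveSpace hgr L' hgr' h0 hD hD' k,
    L.range_clebschGordanMap_eq_inf_eigenspace hgr L' hgr' h0 (by omega) (by omega),
    show ab.1 + ab.2 - 2 * ((ab.1 + ab.2 - k) / 2) = k by omega]

/-- **The joint eigenspaces `P_{−k}(M ⊗ N) ∩ ker(C_M ⊗ 1 − (a²+2a)) ∩ ker(1 ⊗ C_N − (b²+2b))`, `(a, b) ∈ ℕ × ℕ`, are independent.**
[cite: Humphreys1972, §6.2 and §22.5 Exercise 7 (p. 126)] [cite: FultonHarrisGTM129, §11.1] -/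
theorem HasLefschetzProperty.iSupIndep_primitiveSpace_inf_eigenspace (L : HasLefschetzProperty h e) (hgr : IsZGrading h)
    (L' : HasLefschetzProperty h' e') (hgr' : IsZGrading h') (h0 : h.rTensor N + h'.lTensor M ≠ 0) (k : ℕ) :
    iSupIndep fun ab : ℕ × ℕ ↦
      primitiveSpace (h.rTensor N + h'.lTensor M) (e.rTensor N + e'.lTensor M) k ⊓
        Module.End.eigenspace ((Sl2.casimir (-h) (L.dual hgr) e).rTensor N) ((ab.1 * ab.1 + 2 * ab.1 : ℕ) : K) ⊓
        Module.End.eigenspace ((Sl2.casimir (-h') (L'.dual hgr') e').lTensor M) ((ab.2 * ab.2 + 2 * ab.2 : ℕ) : K) := by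
  refine (L.iSupIndep_range_clebschGordanMap hgr L' hgr' fun a b ↦ (a + b - k) / 2).mono fun ab ↦ ?_
  rintro x ⟨⟨hx₁, hx₂⟩, hx₃⟩
  exact L.mem_range_clebschGordanMap_of_casimir hgr L' hgr' h0 hx₁ (Module.End.mem_eigenspace_iff.1 hx₂)
    (Module.End.mem_eigenspace_iff.1 hx₃)

end Abstract

end Literature.Algebra.Lie


/-! ### §2 On `H•((Y × Z)(ℂ); ℂ)`: the index box `a ≤ dim Y`, `b ≤ dim Z`, and the decomposition degree by degree -/

namespace Literature.AlgebraicGeometry.HodgeTheory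

open CategoryTheory MonoidalCategory CartesianMonoidalCategory
open Literature.AlgebraicTopology.SingularHomology
open Literature.AlgebraicGeometry.Motives
open Literature.AlgebraicGeometry.Hyperkaehler
open Literature.Geometry.Kaehler
open Literature.Algebra.Lie
open Literature.Algebra.Lie.HasLefschetzProperty (primitiveSpace mem_primitiveSpace_iff)

variable {m n : ℕ} {Y Z : SchemeOver ℂ}

/-- **`P_{−a}(H•(Y(ℂ); ℂ)) = 0` for `a > dim Y`** (there is no degree `dim Y − a`). [cite: Andre1996Motifs, §1.3 (p. 12, "P_{−i} = P^{d−i}(X)")]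
[cite: LooijengaLunts1997, §1 (1.1) p. 4 ("M = H(X)[n]")] -/
theorem primitiveSpace_complexPoints_eq_bot_of_lt (η : complexBetti Y 2) {a : ℕ} (ha : m < a) :
    primitiveSpace (degreeOperator ℂ (ComplexPoints Y) m) (totalLefschetz η) a = ⊥ := by
  rw [eq_bot_iff]
  intro x hx
  rw [← degreeSpace_degreeOperator_eq_bot (K := ℂ) (Y := ComplexPoints Y) m (m := -(a : ℤ)) (by omega)]
  exact (mem_primitiveSpace_iff.1 hx).1

/-- The Künneth isomorphism as a linear map is the cross map. [cite: HatcherAT2002, §3.2 Thm. 3.16] -/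
private theorem coe_kunnethEquiv' (hY : IsSmoothProjective m Y) (hZ : IsSmoothProjective n Z) :
    ((kunnethEquiv hY hZ : totalCohomology ℂ (ComplexPoints Y) ⊗[ℂ] totalCohomology ℂ (ComplexPoints Z) ≃ₗ[ℂ]
        totalCohomology ℂ (ComplexPoints (Y ⊗ Z))) :
      totalCohomology ℂ (ComplexPoints Y) ⊗[ℂ] totalCohomology ℂ (ComplexPoints Z) →ₗ[ℂ]
        totalCohomology ℂ (ComplexPoints (Y ⊗ Z))) = kunnethCross Y Z :=
  LinearMap.ext fun x ↦ kunnethEquiv_apply hY hZ x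

/-- **André's canonical isomorphism on the carriers, indexed by the box `a ≤ dim Y`, `b ≤ dim Z`**: in `H•((Y × Z)(ℂ); ℂ)` the
`θ`-primitive classes of weight `−k` (`θ = pr_Y^* η + pr_Z^* η'`) are the (independent) sum over `a ≤ m`, `b ≤ n`, `|a − b| ≤ k ≤ a + b`,
`k ≡ a + b (mod 2)` of the Künneth images of `Ψ_{a,b,(a+b−k)/2}(P_{−a}(H•(Y)) ⊗ P_{−b}(H•(Z)))` (`P_{−a}(H•(Y)) = P^{m−a}(Y)`); the
seat's `primitiveSpace_prod_eq_biSup_map_kunnethCross` with the index bound `dim H•` replaced by the dimension.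
[cite: Andre1996Motifs, §1.3 (p. 12)] [cite: HatcherAT2002, §3.2 Thm. 3.16] [cite: LooijengaLunts1997, §1 (1.1) p. 4] -/
theorem primitiveSpace_prod_eq_biSup_map_kunnethCross' (hY : IsSmoothProjective m Y) (hZ : IsSmoothProjective n Z)
    {η : complexBetti Y 2} {η' : complexBetti Z 2} (hη : HasHardLefschetzProperty η m)
    (hη' : HasHardLefschetzProperty η' n) (hmn : 0 < m + n) (k : ℕ) :
    primitiveSpace (degreeOperator ℂ (ComplexPoints (Y ⊗ Z)) (m + n))
        (totalLefschetz (complexBetti.map (fst Y Z) 2 η + complexBetti.map (snd Y Z) 2 η')) k =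
      ⨆ ab ∈ (Finset.range (m + 1) ×ˢ Finset.range (n + 1)).filter
          (fun ab : ℕ × ℕ ↦ ab.1 ≤ ab.2 + k ∧ ab.2 ≤ ab.1 + k ∧ k ≤ ab.1 + ab.2 ∧ (ab.1 + ab.2 + k) % 2 = 0),
        (LinearMap.range (clebschGordanMap (degreeOperator ℂ (ComplexPoints Y) m) (totalLefschetz η)
          (degreeOperator ℂ (ComplexPoints Z) n) (totalLefschetz η') ab.1 ab.2 ((ab.1 + ab.2 - k) / 2))).map
          (kunnethCross Y Z) := by
  haveI := finite_totalCohomology hY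
  haveI := finite_totalCohomology hZ
  have h1 := (hasLefschetzProperty_complexPoints hY hη).biSup_range_clebschGordanMap_eq_primitiveSpace_of_eq_bot
    (isZGrading_degreeOperator m) (hasLefschetzProperty_complexPoints hZ hη') (isZGrading_degreeOperator n)
    (degreeOperator_tensor_ne_zero hY hZ hmn) (D₀ := m + 1) (D₀' := n + 1)
    (fun a ha ↦ primitiveSpace_complexPoints_eq_bot_of_lt η (by omega))
    (fun b hb ↦ primitiveSpace_complexPoints_eq_bot_of_lt η' (by omega)) k
  rw [← coe_kunnethEquiv' hY hZ]
  simp only [← Submodule.map_iSup]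
  rw [h1, map_primitiveSpace_conj, kunnethEquiv_conj_degreeOperator, kunnethEquiv_conj_totalLefschetz]

/-- Pulling back a finite supremum of subspaces of the range of an injective linear map. [folklore] -/
private theorem comap_biSup_eq_of_le_range {V W : Type*} [AddCommGroup V] [Module ℂ V] [AddCommGroup W] [Module ℂ W]
    {f : V →ₗ[ℂ] W} (hf : Function.Injective f) {ι : Type*} (S : Finset ι) {A : ι → Submodule ℂ W}
    (hA : ∀ i ∈ S, A i ≤ LinearMap.range f) :
    (⨆ i ∈ S, A i).comap f = ⨆ i ∈ S, (A i).comap f := by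
  refine le_antisymm (fun x hx ↦ ?_) (iSup₂_le fun i hi ↦ Submodule.comap_mono (le_biSup A hi))
  have hmap : (⨆ i ∈ S, (A i).comap f).map f = ⨆ i ∈ S, A i := by
    simp only [Submodule.map_iSup, Submodule.map_comap_eq]
    exact biSup_congr fun i hi ↦ inf_eq_right.2 (hA i hi)
  obtain ⟨y, hy, hyx⟩ := Submodule.mem_map.1 (hmap.symm ▸ (Submodule.mem_comap.1 hx))
  exact hf hyx ▸ hy

/-- `Hᶜ ↪ H•` is injective. [cite: HatcherAT2002, §3.2 Thm. 3.16] -/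
private theorem ofDegree_injective' (X : SchemeOver ℂ) (c : ℕ) : Function.Injective (ofDegree ℂ (ComplexPoints X) c) :=
  fun x y hxy ↦ DirectSum.of_injective (β := fun k ↦ complexBetti X k) _
    (by rw [← DirectSum.lof_eq_of ℂ, ← DirectSum.lof_eq_of ℂ]; exact hxy)

/-- **THE DECOMPOSITION DEGREE BY DEGREE: `P^c(Y × Z) = ⊕_{(a,b)} P^c(Y × Z)_{(a,b)}`** for `c + k = m + n`, where `P^c(Y × Z) =
ker(L_θ^{k+1} : H^c → H^{2(m+n)−c+2})` is the tree's `lefschetzPrimitive` and the `(a, b)`-summand (`a ≤ m`, `b ≤ n`, `|a − b| ≤ k ≤ a + b`,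
`k ≡ a + b`) is the degree-`c` part of the Künneth image of `Ψ_{a,b,(a+b−k)/2}(P^{m−a}(Y) ⊗ P^{n−b}(Z))` — i.e. (next theorem) the span of
the classes `Σ_l c_l · pr_Y^*(L_ηˡ p) ⌣ pr_Z^*(L_{η'}^{s−l} q)`, `p ∈ P^{m−a}(Y)`, `q ∈ P^{n−b}(Z)`: André's «isomorphisme canonique
`P•(X × Y) ≅ ⊕ P•(X) ⊗ P•(Y)`» read in each cohomological degree. [cite: Andre1996Motifs, §1.3 (p. 12)] [cite: VoisinHodgeI2002, §6.2.3 Def. 6.24]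
[cite: HatcherAT2002, §3.2 Thm. 3.16] -/
theorem lefschetzPrimitive_prod_eq_biSup_comap_ofDegree (hY : IsSmoothProjective m Y) (hZ : IsSmoothProjective n Z)
    {η : complexBetti Y 2} {η' : complexBetti Z 2} (hη : HasHardLefschetzProperty η m)
    (hη' : HasHardLefschetzProperty η' n) (hmn : 0 < m + n) {c k : ℕ} (hck : c + k = m + n) :
    lefschetzPrimitive (complexBetti.map (fst Y Z) 2 η + complexBetti.map (snd Y Z) 2 η')
        (show c + (k + 1) = (m + n) + 1 by omega) =
      ⨆ ab ∈ (Finset.range (m + 1) ×ˢ Finset.range (n + 1)).filter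
          (fun ab : ℕ × ℕ ↦ ab.1 ≤ ab.2 + k ∧ ab.2 ≤ ab.1 + k ∧ k ≤ ab.1 + ab.2 ∧ (ab.1 + ab.2 + k) % 2 = 0),
        ((LinearMap.range (clebschGordanMap (degreeOperator ℂ (ComplexPoints Y) m) (totalLefschetz η)
          (degreeOperator ℂ (ComplexPoints Z) n) (totalLefschetz η') ab.1 ab.2 ((ab.1 + ab.2 - k) / 2))).map
          (kunnethCross Y Z)).comap (ofDegree ℂ (ComplexPoints (Y ⊗ Z)) c) := by
  have hP := primitiveSpace_prod_eq_biSup_map_kunnethCross' hY hZ hη hη' hmn k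
  have hle : primitiveSpace (degreeOperator ℂ (ComplexPoints (Y ⊗ Z)) (m + n))
      (totalLefschetz (complexBetti.map (fst Y Z) 2 η + complexBetti.map (snd Y Z) 2 η')) k ≤
      LinearMap.range (ofDegree ℂ (ComplexPoints (Y ⊗ Z)) c) := by
    rw [← degreeSpace_degreeOperator_eq_range (m + n) c (show (c : ℤ) - (m + n : ℕ) = -(k : ℤ) by push_cast; omega)]
    exact fun x hx ↦ (mem_primitiveSpace_iff.1 hx).1
  have hcomap : lefschetzPrimitive (complexBetti.map (fst Y Z) 2 η + complexBetti.map (snd Y Z) 2 η')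
      (show c + (k + 1) = (m + n) + 1 by omega) =
      (primitiveSpace (degreeOperator ℂ (ComplexPoints (Y ⊗ Z)) (m + n))
        (totalLefschetz (complexBetti.map (fst Y Z) 2 η + complexBetti.map (snd Y Z) 2 η')) k).comap
        (ofDegree ℂ (ComplexPoints (Y ⊗ Z)) c) := by
    ext x
    rw [Submodule.mem_comap, ofDegree_mem_primitiveSpace_iff hck]
  rw [hcomap, hP, comap_biSup_eq_of_le_range (ofDegree_injective' (Y ⊗ Z) c)]
  intro ab hab
  exact (hP ▸ le_biSup (fun ab : ℕ × ℕ ↦ (LinearMap.range (clebschGordanMap (degreeOperator ℂ (ComplexPoints Y) m)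
    (totalLefschetz η) (degreeOperator ℂ (ComplexPoints Z) n) (totalLefschetz η') ab.1 ab.2 ((ab.1 + ab.2 - k) / 2))).map
    (kunnethCross Y Z)) hab).trans hle

/-- **Dictionary: the Künneth image of `Ψ_{a,b,s}(p ⊗ q)` is the homogeneous class `Σ_{l ≤ s} c_l · pr_Y^*(L_ηˡ p) ⌣ pr_Z^*(L_{η'}^{s−l} q) ∈
H^{i+j+2s}((Y × Z)(ℂ); ℂ)`** for `p ∈ Pⁱ(Y)` (`i + a = m`), `q ∈ Pʲ(Z)` (`j + b = n`), `c_l = clebschGordanCoeff a b s l`.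
[cite: Andre1996Motifs, §1.3 (p. 12, "restriction de l'isomorphisme de Künneth")] [cite: HatcherAT2002, §3.2 Thm. 3.16] -/
theorem kunnethCross_clebschGordanMap_tmul (η : complexBetti Y 2) (η' : complexBetti Z 2) {i a j b : ℕ} (hia : i + a = m)
    (hjb : j + b = n) {p : complexBetti Y i} (hp : p ∈ lefschetzPrimitive η (show i + (a + 1) = m + 1 by omega))
    {q : complexBetti Z j} (hq : q ∈ lefschetzPrimitive η' (show j + (b + 1) = n + 1 by omega)) (s : ℕ) :
    kunnethCross Y Z (clebschGordanMap (degreeOperator ℂ (ComplexPoints Y) m) (totalLefschetz η)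
        (degreeOperator ℂ (ComplexPoints Z) n) (totalLefschetz η') a b s
        (⟨ofDegree ℂ (ComplexPoints Y) i p, (ofDegree_mem_primitiveSpace_iff hia η p).2 hp⟩ ⊗ₜ[ℂ]
          ⟨ofDegree ℂ (ComplexPoints Z) j q, (ofDegree_mem_primitiveSpace_iff hjb η' q).2 hq⟩)) =
      ofDegree ℂ (ComplexPoints (Y ⊗ Z)) (i + j + 2 * s) (∑ l : Fin (s + 1),
        ((clebschGordanCoeff a b s l : ℤ) : ℂ) •
          cupProduct (show (i + 2 * (l : ℕ)) + (j + 2 * (s - l)) = i + j + 2 * s by have := l.isLt; omega)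
            (complexBetti.map (fst Y Z) (i + 2 * (l : ℕ)) (lefschetzPow η l i p))
            (complexBetti.map (snd Y Z) (j + 2 * (s - l)) (lefschetzPow η' (s - l) j q))) := by
  rw [clebschGordanMap_tmul, map_sum, map_sum, Finset.sum_range]
  refine Finset.sum_congr rfl fun l _ ↦ ?_
  rw [map_smul, map_smul, pow_totalLefschetz_ofDegree, pow_totalLefschetz_ofDegree, totalCross_tmul_ofDegree,
    ofDegree_cupProduct_index rfl (show (i + 2 * (l : ℕ)) + (j + 2 * (s - l)) = i + j + 2 * s by have := l.isLt; omega)]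

/-- **The `(a, b)`-summand in degree `c = i + j + 2s` is the span of the Clebsch–Gordan classes**: the degree-`(i+j+2s)` part of the
Künneth image of `Ψ_{a,b,s}(P_{−a}(H•(Y)) ⊗ P_{−b}(H•(Z)))` is `span {Σ_l c_l · pr_Y^*(L_ηˡ p) ⌣ pr_Z^*(L_{η'}^{s−l} q) | p ∈ Pⁱ(Y), q ∈ Pʲ(Z)}`
(`i + a = m`, `j + b = n`). [cite: Andre1996Motifs, §1.3 (p. 12)] [cite: VoisinHodgeI2002, §6.2.3 Def. 6.24] [cite: HatcherAT2002, §3.2 Thm. 3.16] -/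
theorem comap_ofDegree_map_kunnethCross_range_clebschGordanMap (η : complexBetti Y 2) (η' : complexBetti Z 2) {i a j b : ℕ}
    (hia : i + a = m) (hjb : j + b = n) (s : ℕ) :
    ((LinearMap.range (clebschGordanMap (degreeOperator ℂ (ComplexPoints Y) m) (totalLefschetz η)
        (degreeOperator ℂ (ComplexPoints Z) n) (totalLefschetz η') a b s)).map (kunnethCross Y Z)).comap
        (ofDegree ℂ (ComplexPoints (Y ⊗ Z)) (i + j + 2 * s)) =
      Submodule.span ℂ {x | ∃ p ∈ lefschetzPrimitive η (show i + (a + 1) = m + 1 by omega),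
        ∃ q ∈ lefschetzPrimitive η' (show j + (b + 1) = n + 1 by omega),
          x = ∑ l : Fin (s + 1), ((clebschGordanCoeff a b s l : ℤ) : ℂ) •
            cupProduct (show (i + 2 * (l : ℕ)) + (j + 2 * (s - l)) = i + j + 2 * s by have := l.isLt; omega)
              (complexBetti.map (fst Y Z) (i + 2 * (l : ℕ)) (lefschetzPow η l i p))
              (complexBetti.map (snd Y Z) (j + 2 * (s - l)) (lefschetzPow η' (s - l) j q))} := by
  set Ψ := clebschGordanMap (degreeOperator ℂ (ComplexPoints Y) m) (totalLefschetz η) (degreeOperator ℂ (ComplexPoints Z) n)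
    (totalLefschetz η') a b s with hΨ
  set T : Set (complexBetti (Y ⊗ Z) (i + j + 2 * s)) := {x | ∃ p ∈ lefschetzPrimitive η (show i + (a + 1) = m + 1 by omega),
        ∃ q ∈ lefschetzPrimitive η' (show j + (b + 1) = n + 1 by omega),
          x = ∑ l : Fin (s + 1), ((clebschGordanCoeff a b s l : ℤ) : ℂ) •
            cupProduct (show (i + 2 * (l : ℕ)) + (j + 2 * (s - l)) = i + j + 2 * s by have := l.isLt; omega)
              (complexBetti.map (fst Y Z) (i + 2 * (l : ℕ)) (lefschetzPow η l i p))
              (complexBetti.map (snd Y Z) (j + 2 * (s - l)) (lefschetzPow η' (s - l) j q))} with hT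
  refine le_antisymm (fun x hx ↦ ?_) (Submodule.span_le.2 ?_)
  · -- `⊆`: the range of `κ ∘ Ψ` is spanned by the images of pure tensors, which are `ofDegree` of generators
    have hrange : (LinearMap.range Ψ).map (kunnethCross Y Z) ≤ (Submodule.span ℂ T).map (ofDegree ℂ (ComplexPoints (Y ⊗ Z)) (i + j + 2 * s)) := by
      rw [LinearMap.range_eq_map, ← TensorProduct.span_tmul_eq_top, Submodule.map_span, Submodule.map_span, Submodule.map_span]
      refine Submodule.span_mono ?_
      rintro _ ⟨_, ⟨_, ⟨p', q', rfl⟩, rfl⟩, rfl⟩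
      obtain ⟨p, hp⟩ : (p' : totalCohomology ℂ (ComplexPoints Y)) ∈ LinearMap.range (ofDegree ℂ (ComplexPoints Y) i) := by
        rw [← degreeSpace_degreeOperator_eq_range m i (show (i : ℤ) - (m : ℕ) = -(a : ℤ) by omega)]
        exact (mem_primitiveSpace_iff.1 p'.2).1
      obtain ⟨q, hq⟩ : (q' : totalCohomology ℂ (ComplexPoints Z)) ∈ LinearMap.range (ofDegree ℂ (ComplexPoints Z) j) := by
        rw [← degreeSpace_degreeOperator_eq_range n j (show (j : ℤ) - (n : ℕ) = -(b : ℤ) by omega)]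
        exact (mem_primitiveSpace_iff.1 q'.2).1
      have hp₁ : p ∈ lefschetzPrimitive η (show i + (a + 1) = m + 1 by omega) :=
        (ofDegree_mem_primitiveSpace_iff hia η p).1 (hp ▸ p'.2)
      have hq₁ : q ∈ lefschetzPrimitive η' (show j + (b + 1) = n + 1 by omega) :=
        (ofDegree_mem_primitiveSpace_iff hjb η' q).1 (hq ▸ q'.2)
      have hp' : p' = ⟨ofDegree ℂ (ComplexPoints Y) i p, (ofDegree_mem_primitiveSpace_iff hia η p).2 hp₁⟩ := Subtype.ext hp.symm
      have hq' : q' = ⟨ofDegree ℂ (ComplexPoints Z) j q, (ofDegree_mem_primitiveSpace_iff hjb η' q).2 hq₁⟩ := Subtype.ext hq.symm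
      rw [hp', hq', hΨ, kunnethCross_clebschGordanMap_tmul η η' hia hjb hp₁ hq₁ s]
      exact Set.mem_image_of_mem _ ⟨p, hp₁, q, hq₁, rfl⟩
    obtain ⟨y, hy, hyx⟩ := Submodule.mem_map.1 (hrange (Submodule.mem_comap.1 hx))
    exact ofDegree_injective' (Y ⊗ Z) (i + j + 2 * s) hyx ▸ hy
  · -- `⊇`: each generator is the Künneth image of `Ψ(p ⊗ q)`
    rintro x ⟨p, hp, q, hq, rfl⟩
    rw [SetLike.mem_coe, Submodule.mem_comap, ← kunnethCross_clebschGordanMap_tmul η η' hia hjb hp hq s]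
    exact Submodule.mem_map_of_mem (LinearMap.mem_range_self Ψ _)

end Literature.AlgebraicGeometry.HodgeTheory

end
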